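import Mathlib.RingTheory.NoetherNormalization
import Mathlib.RingTheory.Nullstellensatz
import Mathlib.RingTheory.TensorProduct.MvPolynomial
import Mathlib.RingTheory.IntegralClosure.IsIntegralClosure.Basic
import Literature.RingTheory.KrullDimension.AffineDimension
import Literature.RingTheory.KrullDimension.BaseChangeDimension
import HarnessLib

/-!
# Krull dimension and transcendence degree over a field of definition

Standard commutative algebra comparing, for a field extension `k → F` and finitely many
variables, quotients of `k[X]` with quotients of `F[X]` (Görtz–Wedhorn, *Algebraic Geometry I*,
2nd ed., Prop. 5.38: `dim X = dim X ⊗ₖ K`; Matsumura, *Commutative Ring Theory*, Thm 5.6, Thm 9.4):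

* `ringKrullDim_quotient_le_of_forall_map_mem` — **extending the coefficient field does not raise
  the dimension**: if every polynomial of `J ⊆ k[X]` maps into `I ⊆ F[X]`, then
  `dim F[X] ⧸ I ≤ dim k[X] ⧸ J`. (Noether normalisation `k[t₁, …, tₛ] ↪ k[X] ⧸ J` finite; then
  `F[X] ⧸ I` is generated over `F` by elements integral over `F[t₁, …, tₛ]`, hence is an integral
  `F[t]`-algebra, so `dim F[X] ⧸ I ≤ dim F[t] = s = dim k[X] ⧸ J` by incomparability.) In
  geometric terms: for a set `S` of `F`-points, the Zariski closure of `S` over `F` has dimension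
  at most that of its closure over `k` (`ringKrullDim_quotient_vanishingIdeal_le`).
* `ringKrullDim_quotient_vanishingIdeal_eq` — **the dimension of an irreducible `F`-variety can be
  computed over any field of definition**: if `W = Z_F(J)` for an ideal `J ⊆ k[X]`, `F` is
  algebraically closed and `I_F(W)` is prime, then `dim F[X] ⧸ I_F(W) = dim k[X] ⧸ I_k(W)`
  (`I_F(W)` is the radical of `I_k(W)·F[X]` by the Nullstellensatz, hence its unique minimal
  prime, and the components of a base change have the dimension of the variety,
  `Literature.RingTheory.KrullDimension.ringKrullDim_quotient_eq_of_isPushout_of_mem_minimalPrimes`).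
* `trdeg_adjoin_le_of_mem` — consequently every point `z ∈ W` generates over `k` an algebra of
  transcendence degree at most `dim W` ("a point of a `k`-variety of dimension `d` has
  transcendence degree `≤ d` over `k`", the form used for loci in Zilber–Bays–Kirby).

Auxiliary: `zeroLocus_map` (the `F`-zero set of `J·F[X]` is the zero set of `J`),
`comap_vanishingIdeal` (`I_F(W) ∩ k[X] = I_k(W)`).

## References

* U. Görtz, T. Wedhorn, *Algebraic Geometry I: Schemes*, 2nd ed. (2020), Prop. 5.38.
* H. Matsumura, *Commutative Ring Theory*, CUP (1986), Thm 5.6, Thm 9.4.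
-/

noncomputable section

open MvPolynomial

namespace Literature.RingTheory.KrullDimension

universe u

/-! ### Extending the coefficient field does not raise the dimension -/

section Extension

variable {k F : Type*} [Field k] [Field F] [Algebra k F] {ι : Type*} [Finite ι]

/-- **`dim F[X] ⧸ I ≤ dim k[X] ⧸ J` whenever `J` maps into `I`** along the coefficient extension
`k[X] → F[X]` (Görtz–Wedhorn I, Prop. 5.38, the inequality half, for an arbitrary quotient of the
base change): Noether-normalise `k[t₁, …, tₛ] ↪ k[X] ⧸ J` (finite, `s = dim k[X] ⧸ J`); the
`F`-algebra `F[X] ⧸ I` is generated by the classes of the variables, which are integral over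
`k[t]` and hence over `F[t]`, so `F[X] ⧸ I` is integral over `F[t₁, …, tₛ]` and has dimension
`≤ s` (incomparability, `ringKrullDim_le_of_isIntegral`). [cite: GortzWedhorn2020, Prop. 5.38] -/
theorem ringKrullDim_quotient_le_of_forall_map_mem (J : Ideal (MvPolynomial ι k))
    (I : Ideal (MvPolynomial ι F)) (hJI : ∀ f ∈ J, MvPolynomial.map (algebraMap k F) f ∈ I) :
    ringKrullDim (MvPolynomial ι F ⧸ I) ≤ ringKrullDim (MvPolynomial ι k ⧸ J) := by
  classical
  by_cases hI : I = ⊤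
  · haveI : Subsingleton (MvPolynomial ι F ⧸ I) := Ideal.Quotient.subsingleton_iff.2 hI
    rw [ringKrullDim_eq_bot_of_subsingleton]
    exact bot_le
  have hJ : J ≠ ⊤ := by
    intro hJ
    apply hI
    rw [Ideal.eq_top_iff_one] at hJ ⊢
    simpa using hJI 1 hJ
  set A := MvPolynomial ι k ⧸ J with hA
  set B := MvPolynomial ι F ⧸ I with hB
  haveI : Nontrivial A := Ideal.Quotient.nontrivial_iff.mpr hJ
  haveI : Nontrivial B := Ideal.Quotient.nontrivial_iff.mpr hI
  haveI : Algebra.FiniteType k A :=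
    Algebra.FiniteType.of_surjective (Ideal.Quotient.mkₐ k J) (Ideal.Quotient.mkₐ_surjective k J)
  -- Noether normalisation of `A`
  obtain ⟨s, g, hg, hfin⟩ := exists_finite_inj_algHom_of_fg k A
  set T := MvPolynomial (Fin s) k with hT
  letI algTA : Algebra T A := g.toRingHom.toAlgebra
  haveI : Module.Finite T A := hfin
  haveI : Algebra.IsIntegral T A := inferInstance
  have hdimA : ringKrullDim A = s := by
    rw [← ringKrullDim_eq_of_isIntegral (R := T) (S := A) hg,
      MvPolynomial.ringKrullDim_of_isNoetherianRing, ringKrullDim_eq_zero_of_field,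
      Nat.card_eq_fintype_card, Fintype.card_fin, zero_add]
  -- the comparison map `φ : A → B`
  have hJI' : J ≤ I.comap (MvPolynomial.mapAlgHom (σ := ι) (Algebra.ofId k F)) := by
    intro f hf
    rw [Ideal.mem_comap]
    exact hJI f hf
  let φ : A →ₐ[k] B := Ideal.quotientMapₐ I (MvPolynomial.mapAlgHom (σ := ι) (Algebra.ofId k F)) hJI'
  have hφ : ∀ f : MvPolynomial ι k,
      φ (Ideal.Quotient.mk J f) = Ideal.Quotient.mk I (MvPolynomial.map (algebraMap k F) f) :=
    fun f => rfl
  -- `B` as an algebra over `T = k[t]` and over `F[t]`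
  let ψ : T →+* B := (φ : A →+* B).comp (algebraMap T A)
  let y : Fin s → B := fun i => ψ (X i)
  let Ψ : MvPolynomial (Fin s) F →ₐ[F] B := aeval y
  letI algTB : Algebra T B := ψ.toAlgebra
  letI algTFB : Algebra (MvPolynomial (Fin s) F) B := Ψ.toRingHom.toAlgebra
  have hψΨ : ψ = Ψ.toRingHom.comp (MvPolynomial.map (algebraMap k F)) := by
    refine MvPolynomial.ringHom_ext (fun c => ?_) (fun i => ?_)
    · have h1 : g (C c) = algebraMap k A c := g.commutes c
      have h2 : Ψ (C (algebraMap k F c)) = algebraMap k B c := by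
        rw [show (C (algebraMap k F c) : MvPolynomial (Fin s) F) =
            algebraMap F (MvPolynomial (Fin s) F) (algebraMap k F c) from rfl, Ψ.commutes,
          ← IsScalarTower.algebraMap_apply]
      change φ (g (C c)) = Ψ (MvPolynomial.map (algebraMap k F) (C c))
      rw [map_C, h1, φ.commutes, h2]
    · change ψ (X i) = Ψ (MvPolynomial.map (algebraMap k F) (X i))
      rw [map_X]
      change y i = aeval y (X i)
      rw [aeval_X]
  letI : Algebra T (MvPolynomial (Fin s) F) := MvPolynomial.algebraMvPolynomial
  haveI : IsScalarTower T (MvPolynomial (Fin s) F) B :=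
    IsScalarTower.of_algebraMap_eq fun p => by
      change ψ p = Ψ (MvPolynomial.map (algebraMap k F) p)
      rw [hψΨ]; rfl
  haveI : IsScalarTower F (MvPolynomial (Fin s) F) B :=
    IsScalarTower.of_algebraMap_eq fun c => (Ψ.commutes c).symm
  -- the classes of the variables are integral over `F[t]`
  have hx : ∀ j : ι, IsIntegral (MvPolynomial (Fin s) F) (Ideal.Quotient.mk I (X j) : B) := by
    intro j
    have h1 : IsIntegral T (Ideal.Quotient.mk J (X j) : A) := Algebra.IsIntegral.isIntegral _
    let φT : A →ₐ[T] B := { (φ : A →+* B) with commutes' := fun _ => rfl }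
    have h2 : IsIntegral T (φT (Ideal.Quotient.mk J (X j))) := h1.map φT
    have h3 : φT (Ideal.Quotient.mk J (X j)) = Ideal.Quotient.mk I (X j) := by
      change φ (Ideal.Quotient.mk J (X j)) = _
      rw [hφ, map_X]
    rw [h3] at h2
    exact h2.tower_top
  -- hence `B` is integral over `F[t]`
  haveI : Algebra.IsIntegral (MvPolynomial (Fin s) F) B := by
    refine ⟨fun b => ?_⟩
    have hgen : Algebra.adjoin F (Set.range fun j : ι => (Ideal.Quotient.mk I (X j) : B)) = ⊤ := by
      have : (Set.range fun j : ι => (Ideal.Quotient.mk I (X j) : B)) =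
          (Ideal.Quotient.mkₐ F I) '' Set.range (X : ι → MvPolynomial ι F) := by
        rw [← Set.range_comp]; rfl
      rw [this, Algebra.adjoin_image, MvPolynomial.adjoin_range_X, Algebra.map_top,
        AlgHom.range_eq_top]
      exact Ideal.Quotient.mkₐ_surjective F I
    have hle : Algebra.adjoin F (Set.range fun j : ι => (Ideal.Quotient.mk I (X j) : B)) ≤
        (integralClosure (MvPolynomial (Fin s) F) B).restrictScalars F :=
      Algebra.adjoin_le (by rintro _ ⟨j, rfl⟩; exact hx j)
    rw [hgen] at hle
    exact hle Algebra.mem_top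
  calc ringKrullDim B ≤ ringKrullDim (MvPolynomial (Fin s) F) := ringKrullDim_le_of_isIntegral
    _ = s := by
      rw [MvPolynomial.ringKrullDim_of_isNoetherianRing, ringKrullDim_eq_zero_of_field,
        Nat.card_eq_fintype_card, Fintype.card_fin, zero_add]
    _ = ringKrullDim A := hdimA.symm

omit [Finite ι] in
/-- The `F`-zero set of the extended ideal `J·F[X]` is the (two-field) zero set of `J`: a point of
`F^ι` kills every `F`-combination of polynomials of `J` iff it kills `J`. [folklore] -/
theorem zeroLocus_map (J : Ideal (MvPolynomial ι k)) :
    zeroLocus F (J.map (MvPolynomial.map (algebraMap k F))) = zeroLocus F J := by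
  ext x
  simp only [mem_zeroLocus_iff]
  constructor
  · intro hx p hp
    have := hx (MvPolynomial.map (algebraMap k F) p) (Ideal.mem_map_of_mem _ hp)
    rwa [aeval_map_algebraMap] at this
  · intro hx p hp
    refine Submodule.span_induction (p := fun p _ => aeval x p = 0) ?_ ?_ ?_ ?_ hp
    · rintro _ ⟨q, hq, rfl⟩
      rw [aeval_map_algebraMap]
      exact hx q hq
    · simp
    · intro p q _ _ hp hq
      rw [map_add, hp, hq, add_zero]
    · intro a p _ hp
      rw [smul_eq_mul, map_mul, hp, mul_zero]

omit [Finite ι] in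
/-- **`I_F(W) ∩ k[X] = I_k(W)`**: a polynomial over `k` vanishes on `W ⊆ F^ι` iff its image in
`F[X]` does. [folklore] -/
theorem comap_vanishingIdeal (W : Set (ι → F)) :
    (vanishingIdeal F W).comap (MvPolynomial.map (algebraMap k F)) = vanishingIdeal k W := by
  ext f
  simp only [Ideal.mem_comap, mem_vanishingIdeal_iff, aeval_map_algebraMap]

omit [Finite ι] in
/-- A polynomial over `k` vanishing on `W` maps to a polynomial over `F` vanishing on `W`.
[folklore] -/
theorem map_mem_vanishingIdeal {W : Set (ι → F)} {f : MvPolynomial ι k}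
    (hf : f ∈ vanishingIdeal k W) : MvPolynomial.map (algebraMap k F) f ∈ vanishingIdeal F W := by
  rw [← comap_vanishingIdeal (k := k) W, Ideal.mem_comap] at hf
  exact hf

/-- **The closure over `F` of a set of `F`-points is at most as big as its closure over `k`**:
`dim F[X] ⧸ I_F(S) ≤ dim k[X] ⧸ I_k(S)` for every `S ⊆ F^ι`.
[cite: GortzWedhorn2020, Prop. 5.38] -/
theorem ringKrullDim_quotient_vanishingIdeal_le (S : Set (ι → F)) :
    ringKrullDim (MvPolynomial ι F ⧸ vanishingIdeal F S) ≤
      ringKrullDim (MvPolynomial ι k ⧸ vanishingIdeal k S) :=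
  ringKrullDim_quotient_le_of_forall_map_mem _ _ fun _ hf => map_mem_vanishingIdeal hf

end Extension

/-! ### Dimension over a field of definition -/

section Definition

variable {k F : Type u} [Field k] [Field F] [Algebra k F] {ι : Type} [Finite ι] [IsAlgClosed F]

omit [Finite ι] [IsAlgClosed F] in
/-- If `W = Z_F(J)` for an ideal `J ⊆ k[X]`, then `W` is the `F`-zero set of `I_k(W)·F[X]`.
[folklore] -/
theorem zeroLocus_map_vanishingIdeal_eq {W : Set (ι → F)} (J : Ideal (MvPolynomial ι k))
    (hW : W = zeroLocus F J) :
    zeroLocus F ((vanishingIdeal k W).map (MvPolynomial.map (algebraMap k F))) = W := by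
  rw [zeroLocus_map]
  refine Set.Subset.antisymm ?_ (zeroLocus_vanishingIdeal_le W)
  rw [hW]
  exact zeroLocus_anti_mono (le_vanishingIdeal_zeroLocus J)

/-- If `W = Z_F(J)` for an ideal `J ⊆ k[X]` and `F` is algebraically closed, then `I_F(W)` is the
radical of `I_k(W)·F[X]` (Nullstellensatz). [folklore] -/
theorem vanishingIdeal_eq_radical_map {W : Set (ι → F)} (J : Ideal (MvPolynomial ι k))
    (hW : W = zeroLocus F J) :
    vanishingIdeal F W = ((vanishingIdeal k W).map (MvPolynomial.map (algebraMap k F))).radical := by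
  conv_lhs => rw [← zeroLocus_map_vanishingIdeal_eq J hW]
  exact vanishingIdeal_zeroLocus_eq_radical _

/-- If `W = Z_F(J)` is defined over `k`, `F` is algebraically closed and `I_F(W)` is prime, then
`I_F(W)` is a (the) minimal prime over `I_k(W)·F[X]`. [folklore] -/
theorem vanishingIdeal_mem_minimalPrimes_map {W : Set (ι → F)} (J : Ideal (MvPolynomial ι k))
    (hW : W = zeroLocus F J) (hprime : (vanishingIdeal F W).IsPrime) :
    vanishingIdeal F W ∈
      ((vanishingIdeal k W).map (MvPolynomial.map (algebraMap k F))).minimalPrimes := by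
  have hrad := vanishingIdeal_eq_radical_map J hW
  refine ⟨⟨hprime, ?_⟩, ?_⟩
  · rw [hrad]; exact Ideal.le_radical
  · rintro q ⟨hq, hle⟩ _
    rw [hrad]
    exact (hq.radical_le_iff).2 hle

/-- **The dimension of an irreducible variety may be computed over a field of definition**
(Görtz–Wedhorn I, Prop. 5.38, for the irreducible `W = Z_F(J)`, `J ⊆ k[X]`, over an algebraically
closed `F`): `dim F[X] ⧸ I_F(W) = dim k[X] ⧸ I_k(W)`. Indeed `I_F(W)` is the unique minimal prime
of `I_k(W)·F[X]` (`vanishingIdeal_mem_minimalPrimes_map`), it contracts to `I_k(W)`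
(`comap_vanishingIdeal`), and every minimal prime of a base change has the dimension of the
variety (`ringKrullDim_quotient_eq_of_isPushout_of_mem_minimalPrimes`).
[cite: GortzWedhorn2020, Prop. 5.38] -/
theorem ringKrullDim_quotient_vanishingIdeal_eq {W : Set (ι → F)} (J : Ideal (MvPolynomial ι k))
    (hW : W = zeroLocus F J) (hprime : (vanishingIdeal F W).IsPrime) :
    ringKrullDim (MvPolynomial ι F ⧸ vanishingIdeal F W) =
      ringKrullDim (MvPolynomial ι k ⧸ vanishingIdeal k W) := by
  haveI := hprime
  letI : Algebra (MvPolynomial ι k) (MvPolynomial ι F) := MvPolynomial.algebraMvPolynomial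
  have hunder : (vanishingIdeal F W).under (MvPolynomial ι k) = vanishingIdeal k W := by
    rw [Ideal.under_def, MvPolynomial.algebraMap_def]
    exact comap_vanishingIdeal W
  have hmin : vanishingIdeal F W ∈ (((vanishingIdeal F W).under (MvPolynomial ι k)).map
      (algebraMap (MvPolynomial ι k) (MvPolynomial ι F))).minimalPrimes := by
    rw [hunder, MvPolynomial.algebraMap_def]
    exact vanishingIdeal_mem_minimalPrimes_map J hW hprime
  have h := ringKrullDim_quotient_eq_of_isPushout_of_mem_minimalPrimes (k := k) (L := F)
    (R := MvPolynomial ι k) (R' := MvPolynomial ι F) (vanishingIdeal F W) hmin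
  rwa [hunder] at h

omit [Finite ι] [IsAlgClosed F] in
/-- `I_k(W)` is prime when `I_F(W)` is (it is its contraction). [folklore] -/
theorem isPrime_vanishingIdeal_of_isPrime {W : Set (ι → F)} (hprime : (vanishingIdeal F W).IsPrime) :
    (vanishingIdeal k W : Ideal (MvPolynomial ι k)).IsPrime := by
  rw [← comap_vanishingIdeal (k := k) W]
  exact Ideal.IsPrime.comap _

/-- **Points of a `k`-variety of dimension `d` have transcendence degree `≤ d` over `k`**: if
`W = Z_F(J)` (`J ⊆ k[X]`, `F` algebraically closed) is irreducible over `F` of dimension `d`, then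
for every `z ∈ W` the `k`-algebra `k[z]` generated by the coordinates of `z` has `trdeg_k ≤ d`
(`k[z]` is a quotient of `k[X] ⧸ I_k(W)`, whose transcendence degree is its dimension
`= dim F[X] ⧸ I_F(W) = d`). [cite: GortzWedhorn2020, Prop. 5.38] [cite: Matsumura1987, Thm 5.6] -/
theorem trdeg_adjoin_le_of_mem {W : Set (ι → F)} (J : Ideal (MvPolynomial ι k))
    (hW : W = zeroLocus F J) (hprime : (vanishingIdeal F W).IsPrime) {d : ℕ}
    (hd : ringKrullDim (MvPolynomial ι F ⧸ vanishingIdeal F W) = d) {z : ι → F} (hz : z ∈ W) :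
    Algebra.trdeg k (Algebra.adjoin k (Set.range z)) ≤ d := by
  classical
  set P : Ideal (MvPolynomial ι k) := vanishingIdeal k W with hP
  haveI : P.IsPrime := isPrime_vanishingIdeal_of_isPrime hprime
  set A := MvPolynomial ι k ⧸ P with hA
  haveI : IsDomain A := Ideal.Quotient.isDomain P
  haveI : Algebra.FiniteType k A :=
    Algebra.FiniteType.of_surjective (Ideal.Quotient.mkₐ k P) (Ideal.Quotient.mkₐ_surjective k P)
  -- `trdeg_k A = d`
  have hdimA : ringKrullDim A = d :=
    (ringKrullDim_quotient_vanishingIdeal_eq J hW hprime).symm.trans hd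
  have htrdeg : Algebra.trdeg k A = d := by
    rw [ringKrullDim_eq_trdeg k A] at hdimA
    have h1 : Cardinal.toNat (Algebra.trdeg k A) = d := by exact_mod_cast hdimA
    rw [trdeg_eq_toNat k A, h1]
  -- `k[z]` is a quotient of `A`
  let g₀ : MvPolynomial ι k →ₐ[k] Algebra.adjoin k (Set.range z) :=
    (aeval z).codRestrict (Algebra.adjoin k (Set.range z)) fun f => by
      rw [Algebra.adjoin_range_eq_range_aeval]; exact ⟨f, rfl⟩
  have hg₀ : Function.Surjective g₀ := by
    rintro ⟨y, hy⟩
    rw [Algebra.adjoin_range_eq_range_aeval] at hy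
    obtain ⟨f, rfl⟩ := hy
    exact ⟨f, rfl⟩
  have hPg₀ : ∀ f ∈ P, g₀ f = 0 := fun f hf => by
    rw [Subtype.ext_iff]
    exact (mem_vanishingIdeal_iff.1 hf) z hz
  let g₁ : A →ₐ[k] Algebra.adjoin k (Set.range z) := Ideal.Quotient.liftₐ P g₀ hPg₀
  have hg₁ : Function.Surjective g₁ := fun y => by
    obtain ⟨f, rfl⟩ := hg₀ y
    exact ⟨Ideal.Quotient.mk P f, rfl⟩
  rw [← htrdeg]
  exact trdeg_le_of_surjective g₁ hg₁

end Definition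

end Literature.RingTheory.KrullDimension
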